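import Summits.MatrixMultiplication.OmegaCensus.C2Quaternion16Prelim
import HarnessLib

/-!
# Dicyclic type, `|A| = 16`: the shape `(1,1 | 1,2 | 2,4)` does not occur when `A/⟨c₀⟩` has no exact 3-piece tiling

ω-census, family (b3).  Framing: lottery ticket; floor = certified bounds/negative ranges.

`no_36_shape_d` excludes the `law − 4` pattern `(1,1 | 1,2 | 2,4)` at `|A| = 16`: the vertex `111` is exact, so `U₁` is
`c₀`-periodic and `T₁ + U₀` is periodic (`periodic_of_exact_vertex`); by `two_set_sum_periodic` either `T₁` is periodic
(`S₀+T₁+U₁` not injective), or `U₀` is a `⟨c₀⟩`-coset (the exact vertex descends to the forbidden tiling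
`hQ` of `A/⟨c₀⟩ ≅ ℤ₂ × ℤ₄`), or `T₁ = {t₁, t₁+d}`, `2d = 0`, `U₀ = {u₁, u₁+d+c₀}` (the vertex `001` of
`(S,T,U·τ0)` makes `U₁` `d`-invariant, and `t₁ + (v+d) = (t₁+d) + v` breaks the injectivity of `T₁ + U₁`).
-/

namespace Summit.MatrixMultiplication.OmegaCensus

open Literature.Combinatorics.Additive Finset

section ShapeD

variable {A : Type*} [AddCommGroup A] [DecidableEq A] [Fintype A] {G : Type} [Group G] [DecidableEq G]
  {ρ τ : A → G} {c₀ : A} {S T U : Finset G} {Q : Type*} [AddCommGroup Q] [DecidableEq Q]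

/-- **Shape `(1,1 | 1,2 | 2,4)` is impossible in dicyclic type with `|A| = 16`**, given a projection `π : A → Q` with
fibres `{x, x + c₀}` onto a group `Q` without the exact tiling `{0,d,e,d+e} ⊔ {a,a+e} ⊔ {b,b+d}` (abstract form of
`no_36_shape_d`; `Q = ℤ₂ × ℤ₄`: `z2z4_no_exact_tiling`, `Q = ℤ₂³`: `z2z2z2_no_exact_tiling`). [folklore] -/
theorem no_36_shape_d_abs
    (hρρ : ∀ a b, ρ a * ρ b = ρ (a + b)) (hρτ : ∀ a b, ρ a * τ b = τ (b - a))
    (hτρ : ∀ a b, τ a * ρ b = τ (a + b))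
    (hττ : ∀ a b, τ a * τ b = ρ (c₀ + b - a))
    (hρ : Function.Injective ρ) (hτ : Function.Injective τ) (hne : ∀ a b, ρ a ≠ τ b)
    (hc₀ : c₀ ≠ 0) (hA : Fintype.card A = 16)
    (h : TripleProductProperty S T U)
    (hs₀ : (univ.filter fun a : A => ρ a ∈ S).card = 1)
    (hs₁ : (univ.filter fun a : A => τ a ∈ S).card = 1)
    (ht₀ : (univ.filter fun a : A => ρ a ∈ T).card = 1)
    (ht₁ : (univ.filter fun a : A => τ a ∈ T).card = 2)
    (hu₀ : (univ.filter fun a : A => ρ a ∈ U).card = 2)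
    (hu₁ : (univ.filter fun a : A => τ a ∈ U).card = 4)
    (π : A →+ Q) (hπ : ∀ X Y : A, π X = π Y ↔ (Y = X ∨ Y = X + c₀))
    (hQ : ∀ d e a b : Q, d ≠ 0 → e ≠ 0 → d ≠ e → d + e ≠ 0 →
      a ∉ ({0, d, e, d + e} : Finset Q) → a + e ∉ ({0, d, e, d + e} : Finset Q) →
      b ∉ ({0, d, e, d + e} : Finset Q) → b + d ∉ ({0, d, e, d + e} : Finset Q) →
      a ≠ b → a ≠ b + d → a + e ≠ b → a + e ≠ b + d → False) : False := by
  have h2c : c₀ + c₀ = 0 := two_c0_eq_zero hρτ hτρ hττ hτ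
  have hnegc : -c₀ = c₀ := neg_shift h2c
  set S₀ : Finset (A) := univ.filter fun a => ρ a ∈ S with hS₀
  set S₁ : Finset (A) := univ.filter fun a => τ a ∈ S with hS₁
  set T₀ : Finset (A) := univ.filter fun a => ρ a ∈ T with hT₀
  set T₁ : Finset (A) := univ.filter fun a => τ a ∈ T with hT₁
  set U₀ : Finset (A) := univ.filter fun a => ρ a ∈ U with hU₀
  set U₁ : Finset (A) := univ.filter fun a => τ a ∈ U with hU₁
  have mS₀ : ∀ a ∈ S₀, cond false (τ a) (ρ a) ∈ S := fun a ha => by simpa [hS₀] using ha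
  have mS₁ : ∀ a ∈ S₁, cond true (τ a) (ρ a) ∈ S := fun a ha => by simpa [hS₁] using ha
  have mT₀ : ∀ a ∈ T₀, cond false (τ a) (ρ a) ∈ T := fun a ha => by simpa [hT₀] using ha
  have mT₁ : ∀ a ∈ T₁, cond true (τ a) (ρ a) ∈ T := fun a ha => by simpa [hT₁] using ha
  have mU₀ : ∀ a ∈ U₀, cond false (τ a) (ρ a) ∈ U := fun a ha => by simpa [hU₀] using ha
  have mU₁ : ∀ a ∈ U₁, cond true (τ a) (ρ a) ∈ U := fun a ha => by simpa [hU₁] using ha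
  have cs := card_sumset' hρρ hττ hρ hτ h
  have inj := sum_injOn' hρρ hττ hρ hτ h
  obtain ⟨a₀, hS₀a⟩ := card_eq_one.1 hs₀
  obtain ⟨s, hS₁s⟩ := card_eq_one.1 hs₁
  obtain ⟨t, hT₀t⟩ := card_eq_one.1 ht₀
  obtain ⟨t₁, t₂, ht12, hT₁eq⟩ := card_eq_two.1 ht₁
  obtain ⟨u₁, u₂, hu12, hU₀eq⟩ := card_eq_two.1 hu₀
  have ht₁m : t₁ ∈ T₁ := by rw [hT₁eq]; simp
  have ht₂m : t₂ ∈ T₁ := by rw [hT₁eq]; simp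
  have hu₁m : u₁ ∈ U₀ := by rw [hU₀eq]; simp
  have hu₂m : u₂ ∈ U₀ := by rw [hU₀eq]; simp
  have memT₁ : ∀ x ∈ T₁, x = t₁ ∨ x = t₂ := fun x hx => by simpa [hT₁eq] using hx
  have memU₀ : ∀ x ∈ U₀, x = u₁ ∨ x = u₂ := fun x hx => by simpa [hU₀eq] using hx
  have iTU₁ := pairs_of_sum_injOn_fst (by rw [← hS₀a]; exact inj false true true mS₀ mT₁ mU₁)
  have hU₁ne : U₁.Nonempty := card_pos.1 (by rw [hu₁]; norm_num)
  set B011 := (S₀ ×ˢ T₁ ×ˢ U₁).image fun p : (A) × (A) × (A) =>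
    p.1 + p.2.1 + p.2.2 with hB011
  set B101 := (S₁ ×ˢ T₀ ×ˢ U₁).image fun p : (A) × (A) × (A) =>
    p.1 + p.2.1 + p.2.2 with hB101
  set B110 := (S₁ ×ˢ T₁ ×ˢ U₀).image fun p : (A) × (A) × (A) =>
    p.1 + p.2.1 + p.2.2 with hB110
  have d₁ : Disjoint B101 B011 := (disjoint_sumset₁' hρρ hρτ hτρ hττ hne h) true mS₁ mT₀ mU₁ mS₀ mT₁
  have d₂ : Disjoint B110 B101 := (disjoint_sumset₂' hρρ hρτ hτρ hττ hne h) true mS₁ mT₁ mU₀ mS₁ mT₀ mU₁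
  have d₃ : Disjoint B011 B110 := (disjoint_sumset₃' hρρ hρτ hτρ hττ hne h) true mS₀ mT₁ mU₁ mS₁ mU₀
  have sh₁ : Disjoint B101 (B011.image (· + c₀)) :=
    (disjoint_sumset₁_shift' hρρ hρτ hττ hne h) true mS₁ mT₀ mU₁ mS₀ mT₁
  have sh₂ : Disjoint (B101.image (· + c₀)) B110 :=
    (disjoint_sumset₂_shift' hρρ hρτ hττ hne h) true mS₁ mT₀ mU₁ mS₁ mT₁ mU₀
  have sh₃ : Disjoint B110 (B011.image (· + c₀)) :=
    (disjoint_sumset₃_shift' hρρ hρτ hτρ hττ hne h) true mS₁ mT₁ mU₀ mS₀ mU₁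
  have c011 : B011.card = 8 := by rw [hB011, cs false true true mS₀ mT₁ mU₁, hs₀, ht₁, hu₁]
  have c101 : B101.card = 4 := by rw [hB101, cs true false true mS₁ mT₀ mU₁, hs₁, ht₀, hu₁]
  have c110 : B110.card = 4 := by rw [hB110, cs true true false mS₁ mT₁ mU₀, hs₁, ht₁, hu₀]
  have hper101 : B101.image (· + c₀) = B101 :=
    periodic_of_exact_vertex d₁ d₂.symm d₃ (by rw [c011, c101, c110, hA])
      (disjoint_image_add_comm h2c sh₁) sh₂
  have hper110 : B110.image (· + c₀) = B110 :=
    periodic_of_exact_vertex d₃.symm d₂ d₁.symm (by rw [c011, c101, c110, hA])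
      (disjoint_image_add_comm h2c sh₃) (disjoint_image_add_comm h2c sh₂.symm)
  have hU₁per : U₁.image (· + c₀) = U₁ := by
    rw [hB101, hS₁s, hT₀t] at hper101; exact periodic_third_of_box_singletons hper101
  have absU₁ : ∀ z ∈ U₁, ∀ κ : A, (κ = 0 ∨ κ = c₀) → z + κ ∈ U₁ := by
    rintro z hz κ (hk | hk) <;> subst κ
    · rw [add_zero]; exact hz
    · rw [← hU₁per]; exact mem_image_of_mem _ hz
  have mB110 : ∀ x ∈ T₁, ∀ z ∈ U₀, s + x + z ∈ B110 := fun x hx z hz => by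
    rw [hB110]; exact mem_sumset₃.2 ⟨s, by rw [hS₁s]; exact mem_singleton_self _, x, hx, z, hz, rfl⟩
  have mB011 : ∀ x ∈ T₁, ∀ z ∈ U₁, a₀ + x + z ∈ B011 := fun x hx z hz => by
    rw [hB011]; exact mem_sumset₃.2 ⟨a₀, by rw [hS₀a]; exact mem_singleton_self _, x, hx, z, hz, rfl⟩
  have mB101 : ∀ z ∈ U₁, s + t + z ∈ B101 := fun z hz => by
    rw [hB101]; exact mem_sumset₃.2 ⟨s, by rw [hS₁s]; exact mem_singleton_self _, t, by
      rw [hT₀t]; exact mem_singleton_self _, z, hz, rfl⟩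
  have hcrit : t₂ - t₁ = c₀ ∨ u₂ - u₁ = c₀ ∨ ((t₂ - t₁) + (t₂ - t₁) = 0 ∧ (t₂ - t₁) + (u₂ - u₁) = c₀) := by
    apply two_set_sum_periodic hc₀ h2c (sub_ne_zero.2 ht12.symm) (sub_ne_zero.2 hu12.symm)
    intro q hq
    have hq' : s + t₁ + u₁ + q ∈ B110 := by
      simp only [mem_insert, mem_singleton] at hq
      rcases hq with rfl | rfl | rfl | rfl
      · rw [add_zero]; exact mB110 t₁ ht₁m u₁ hu₁m
      · rw [show s + t₁ + u₁ + (u₂ - u₁) = s + t₁ + u₂ by abel]; exact mB110 t₁ ht₁m u₂ hu₂m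
      · rw [show s + t₁ + u₁ + (t₂ - t₁) = s + t₂ + u₁ by abel]; exact mB110 t₂ ht₂m u₁ hu₁m
      · rw [show s + t₁ + u₁ + (t₂ - t₁ + (u₂ - u₁)) = s + t₂ + u₂ by abel]; exact mB110 t₂ ht₂m u₂ hu₂m
    have hqc : s + t₁ + u₁ + q + c₀ ∈ B110 := by rw [← hper110]; exact mem_image_of_mem _ hq'
    rw [hB110, mem_sumset₃] at hqc
    obtain ⟨a, ha, x, hx, z, hz, he⟩ := hqc
    rw [hS₁s, mem_singleton] at ha
    simp only [mem_insert, mem_singleton]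
    rcases memT₁ x hx with hx' | hx' <;> rcases memU₀ z hz with hz' | hz' <;> rw [ha, hx', hz'] at he
    · left; linear_combination (norm := abel1) -he
    · right; left; linear_combination (norm := abel1) -he
    · right; right; left; linear_combination (norm := abel1) -he
    · right; right; right; linear_combination (norm := abel1) -he
  by_cases hdT : t₂ - t₁ = c₀
  · have hT₁per : T₁.image (· + c₀) = T₁ := by
      rw [hT₁eq, image_insert, image_singleton]
      have e1 : t₁ + c₀ = t₂ := by rw [← hdT]; abel
      have e2 : t₂ + c₀ = t₁ := by linear_combination (norm := abel1) hdT + h2c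
      rw [e1, e2, pair_comm]
    exact not_injOn_of_periodic₂₃ hc₀ hT₁per hU₁per ⟨a₀, by rw [hS₀a]; exact mem_singleton_self _⟩ ⟨t₁, ht₁m⟩
      hU₁ne (inj false true true mS₀ mT₁ mU₁)
  by_cases hdU : u₂ - u₁ = c₀
  · have absU₀ : ∀ z ∈ U₀, ∀ κ : A, (κ = 0 ∨ κ = c₀) → z + κ ∈ U₀ := by
      rintro z hz κ (hk | hk) <;> subst κ
      · rw [add_zero]; exact hz
      · rcases memU₀ z hz with hz1 | hz1 <;> subst z
        · rw [show u₁ + c₀ = u₂ by rw [← hdU]; abel]; exact hu₂m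
        · rw [show u₂ + c₀ = u₁ by linear_combination (norm := abel1) hdU + h2c]; exact hu₁m
    obtain ⟨v, hv⟩ := hU₁ne
    have hlt : ({v, v + c₀} : Finset (A)).card < U₁.card := by
      rw [hu₁]; exact lt_of_le_of_lt (card_insert_le _ _) (by rw [card_singleton]; norm_num)
    obtain ⟨w, hw, hwn⟩ := exists_mem_notMem_of_card_lt_card hlt
    rw [mem_insert, mem_singleton, not_or] at hwn
    have keyκ : ∀ X Y : A, π X = π Y → ∃ κ, (κ = 0 ∨ κ = c₀) ∧ Y = X + κ := by
      intro X Y hXY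
      rcases (hπ X Y).1 hXY with e | e
      · exact ⟨0, Or.inl rfl, by rw [add_zero]; exact e⟩
      · exact ⟨c₀, Or.inr rfl, e⟩
    have key0 : ∀ X : A, π X = 0 → ∃ κ, (κ = 0 ∨ κ = c₀) ∧ X = κ := by
      intro X hX
      obtain ⟨κ, hκ, e⟩ := keyκ 0 X (by rw [map_zero, hX])
      exact ⟨κ, hκ, by rw [e, zero_add]⟩
    have clash₁ : ∀ x ∈ T₁, ∀ z ∈ U₁, ∀ z' ∈ U₁, ∀ κ : A, (κ = 0 ∨ κ = c₀) →
        s + t + z' = a₀ + x + z + κ → False := by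
      intro x hx z hz z' hz' κ hκ e
      refine disjoint_left.1 d₁ (mB101 z' hz') ?_
      rw [e, show a₀ + x + z + κ = a₀ + x + (z + κ) by abel]
      exact mB011 x hx _ (absU₁ z hz κ hκ)
    have clash₂ : ∀ x ∈ T₁, ∀ z ∈ U₁, ∀ x' ∈ T₁, ∀ y ∈ U₀, ∀ κ : A, (κ = 0 ∨ κ = c₀) →
        s + x' + y = a₀ + x + z + κ → False := by
      intro x hx z hz x' hx' y hy κ hκ e
      refine disjoint_left.1 d₃ ?_ (mB110 x' hx' y hy)
      rw [e, show a₀ + x + z + κ = a₀ + x + (z + κ) by abel]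
      exact mB011 x hx _ (absU₁ z hz κ hκ)
    have clash₃ : ∀ z' ∈ U₁, ∀ x' ∈ T₁, ∀ y ∈ U₀, ∀ κ : A, (κ = 0 ∨ κ = c₀) →
        s + x' + y = s + t + z' + κ → False := by
      intro z' hz' x' hx' y hy κ hκ e
      refine disjoint_left.1 d₂ (mB110 x' hx' y hy) ?_
      rw [e, show s + t + z' + κ = s + t + (z' + κ) by abel]
      exact mB101 _ (absU₁ z' hz' κ hκ)
    refine hQ (π (t₂ - t₁)) (π (w - v)) (π (s + t - a₀ - t₁)) (π (s + u₁ - a₀ - v))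
      ?_ ?_ ?_ ?_ ?_ ?_ ?_ ?_ ?_ ?_ ?_ ?_
    · intro hh
      obtain ⟨κ, hκ, e⟩ := key0 _ hh
      rcases hκ with hk | hk <;> rw [hk] at e
      · exact ht12 (by linear_combination (norm := abel1) -e)
      · exact hdT e
    · intro hh
      obtain ⟨κ, hκ, e⟩ := key0 _ hh
      rcases hκ with hk | hk <;> rw [hk] at e
      · exact hwn.1 (by linear_combination (norm := abel1) e)
      · exact hwn.2 (by linear_combination (norm := abel1) e)
    · intro hh
      obtain ⟨κ, hκ, e⟩ := keyκ _ _ hh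
      exact ht12 (iTU₁ t₁ ht₁m t₂ ht₂m w hw (v + κ) (absU₁ v hv κ hκ)
        (by linear_combination (norm := abel1) e)).1
    · intro hh
      rw [← map_add] at hh
      obtain ⟨κ, hκ, e⟩ := key0 _ hh
      exact ht12.symm (iTU₁ t₂ ht₂m t₁ ht₁m w hw (v + κ) (absU₁ v hv κ hκ)
        (by linear_combination (norm := abel1) e)).1
    · intro hh
      simp only [mem_insert, mem_singleton, ← map_add] at hh
      rcases hh with hh | hh | hh | hh
      · obtain ⟨κ, hκ, e⟩ := key0 _ hh
        exact clash₁ t₁ ht₁m v hv v hv κ hκ (by linear_combination (norm := abel1) e)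
      · obtain ⟨κ, hκ, e⟩ := keyκ _ _ hh.symm
        exact clash₁ t₂ ht₂m v hv v hv κ hκ (by linear_combination (norm := abel1) e)
      · obtain ⟨κ, hκ, e⟩ := keyκ _ _ hh.symm
        exact clash₁ t₁ ht₁m w hw v hv κ hκ (by linear_combination (norm := abel1) e)
      · obtain ⟨κ, hκ, e⟩ := keyκ _ _ hh.symm
        exact clash₁ t₂ ht₂m w hw v hv κ hκ (by linear_combination (norm := abel1) e)
    · intro hh
      simp only [mem_insert, mem_singleton, ← map_add] at hh
      rcases hh with hh | hh | hh | hh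
      · obtain ⟨κ, hκ, e⟩ := key0 _ hh
        exact clash₁ t₁ ht₁m v hv w hw κ hκ (by linear_combination (norm := abel1) e)
      · obtain ⟨κ, hκ, e⟩ := keyκ _ _ hh.symm
        exact clash₁ t₂ ht₂m v hv w hw κ hκ (by linear_combination (norm := abel1) e)
      · obtain ⟨κ, hκ, e⟩ := keyκ _ _ hh.symm
        exact clash₁ t₁ ht₁m v hv v hv κ hκ (by linear_combination (norm := abel1) e)
      · obtain ⟨κ, hκ, e⟩ := keyκ _ _ hh.symm
        exact clash₁ t₂ ht₂m v hv v hv κ hκ (by linear_combination (norm := abel1) e)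
    · intro hh
      simp only [mem_insert, mem_singleton, ← map_add] at hh
      rcases hh with hh | hh | hh | hh
      · obtain ⟨κ, hκ, e⟩ := key0 _ hh
        exact clash₂ t₁ ht₁m v hv t₁ ht₁m u₁ hu₁m κ hκ (by linear_combination (norm := abel1) e)
      · obtain ⟨κ, hκ, e⟩ := keyκ _ _ hh.symm
        exact clash₂ t₂ ht₂m v hv t₁ ht₁m u₁ hu₁m κ hκ (by linear_combination (norm := abel1) e)
      · obtain ⟨κ, hκ, e⟩ := keyκ _ _ hh.symm
        exact clash₂ t₁ ht₁m w hw t₁ ht₁m u₁ hu₁m κ hκ (by linear_combination (norm := abel1) e)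
      · obtain ⟨κ, hκ, e⟩ := keyκ _ _ hh.symm
        exact clash₂ t₂ ht₂m w hw t₁ ht₁m u₁ hu₁m κ hκ (by linear_combination (norm := abel1) e)
    · intro hh
      simp only [mem_insert, mem_singleton, ← map_add] at hh
      rcases hh with hh | hh | hh | hh
      · obtain ⟨κ, hκ, e⟩ := key0 _ hh
        exact clash₂ t₁ ht₁m v hv t₂ ht₂m u₁ hu₁m κ hκ (by linear_combination (norm := abel1) e)
      · obtain ⟨κ, hκ, e⟩ := keyκ _ _ hh.symm
        exact clash₂ t₂ ht₂m v hv t₂ ht₂m u₁ hu₁m κ hκ (by linear_combination (norm := abel1) e)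
      · obtain ⟨κ, hκ, e⟩ := keyκ _ _ hh.symm
        exact clash₂ t₁ ht₁m w hw t₂ ht₂m u₁ hu₁m κ hκ (by linear_combination (norm := abel1) e)
      · obtain ⟨κ, hκ, e⟩ := keyκ _ _ hh.symm
        exact clash₂ t₂ ht₂m w hw t₂ ht₂m u₁ hu₁m κ hκ (by linear_combination (norm := abel1) e)
    · intro hh
      obtain ⟨κ, hκ, e⟩ := keyκ _ _ hh
      exact clash₃ v hv t₁ ht₁m u₁ hu₁m κ hκ (by linear_combination (norm := abel1) e)
    · intro hh
      rw [← map_add] at hh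
      obtain ⟨κ, hκ, e⟩ := keyκ _ _ hh
      exact clash₃ v hv t₂ ht₂m u₁ hu₁m κ hκ (by linear_combination (norm := abel1) e)
    · intro hh
      rw [← map_add] at hh
      obtain ⟨κ, hκ, e⟩ := keyκ _ _ hh
      exact clash₃ w hw t₁ ht₁m u₁ hu₁m κ hκ (by linear_combination (norm := abel1) e)
    · intro hh
      rw [← map_add, ← map_add] at hh
      obtain ⟨κ, hκ, e⟩ := keyκ _ _ hh
      exact clash₃ w hw t₂ ht₂m u₁ hu₁m κ hκ (by linear_combination (norm := abel1) e)
  rcases hcrit with h' | h' | ⟨hdd, hde⟩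
  · exact hdT h'
  · exact hdU h'
  set d := t₂ - t₁ with hd
  have ht₂ : t₂ = t₁ + d := by rw [hd]; abel
  have hu₂ : u₂ = u₁ + d + c₀ := by linear_combination (norm := abel1) hde - hdd
  have er : (Equiv.mulRight (1 : G)).toEmbedding = Function.Embedding.refl G := by ext x; simp
  have hU' := h.map_mulRight 1 1 (τ 0)
  simp only [er, Finset.map_refl] at hU'
  set U' := U.map (Equiv.mulRight (τ 0)).toEmbedding with hU'def
  set U₀' : Finset (A) := univ.filter fun a => ρ a ∈ U' with hU₀'
  set U₁' : Finset (A) := univ.filter fun a => τ a ∈ U' with hU₁'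
  have eU₀' : U₀' = U₁.image fun x => -c₀ - x := by rw [hU₀', hU'def, rho_part_mulRight_tau hρρ hρτ hττ, ← hU₁]
  have eU₁' : U₁' = U₀.image fun x => -x := by rw [hU₁', hU'def, tau_part_mulRight_tau hρρ hττ, ← hU₀]
  have mU₀' : ∀ a ∈ U₀', cond false (τ a) (ρ a) ∈ U' := fun a ha => by simpa [hU₀'] using ha
  have mU₁' : ∀ a ∈ U₁', cond true (τ a) (ρ a) ∈ U' := fun a ha => by simpa [hU₁'] using ha
  have cU₀' : U₀'.card = 4 := by rw [eU₀', card_image_of_injective _ sub_right_injective, hu₁]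
  have cU₁' : U₁'.card = 2 := by rw [eU₁', card_image_of_injective _ neg_injective, hu₀]
  have cs' := card_sumset' hρρ hττ hρ hτ hU'
  set N₁ := (S₁ ×ˢ T₀ ×ˢ U₀').image fun p : (A) × (A) × (A) =>
    p.1 + p.2.1 + p.2.2 with hN₁
  set N₂ := (S₀ ×ˢ T₁ ×ˢ U₀').image fun p : (A) × (A) × (A) =>
    p.1 + p.2.1 + p.2.2 with hN₂
  set N₃ := (S₀ ×ˢ T₀ ×ˢ U₁').image fun p : (A) × (A) × (A) =>
    p.1 + p.2.1 + p.2.2 with hN₃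
  have e₁ : Disjoint N₁ N₂ := (disjoint_sumset₁' hρρ hρτ hτρ hττ hne hU') false mS₁ mT₀ mU₀' mS₀ mT₁
  have e₂ : Disjoint N₂ N₃ := (disjoint_sumset₂' hρρ hρτ hτρ hττ hne hU') false mS₀ mT₁ mU₀' mS₀ mT₀ mU₁'
  have e₃ : Disjoint N₃ N₁ := (disjoint_sumset₃' hρρ hρτ hτρ hττ hne hU') false mS₀ mT₀ mU₁' mS₁ mU₀'
  have f₁ : Disjoint N₁ (N₃.image (· + c₀)) :=
    (disjoint_sumset₃_shift' hρρ hρτ hτρ hττ hne hU') false mS₁ mT₀ mU₀' mS₀ mU₁'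
  have f₂ : Disjoint (N₃.image (· + c₀)) N₂ :=
    (disjoint_sumset₂_shift' hρρ hρτ hττ hne hU') false mS₀ mT₀ mU₁' mS₀ mT₁ mU₀'
  have cN₁ : N₁.card = 4 := by rw [hN₁, cs' true false false mS₁ mT₀ mU₀', hs₁, ht₀, cU₀']
  have cN₂ : N₂.card = 8 := by rw [hN₂, cs' false true false mS₀ mT₁ mU₀', hs₀, ht₁, cU₀']
  have cN₃ : N₃.card = 2 := by rw [hN₃, cs' false false true mS₀ mT₀ mU₁', hs₀, ht₀, cU₁']
  have memN₃ : ∀ p ∈ N₃, ∃ y ∈ U₀, p = a₀ + t - y := by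
    intro p hp
    rw [hN₃, mem_sumset₃] at hp
    obtain ⟨a, ha, b, hb, c, hc, rfl⟩ := hp
    rw [hS₀a, mem_singleton] at ha
    rw [hT₀t, mem_singleton] at hb
    rw [eU₁'] at hc
    obtain ⟨y, hy, rfl⟩ := mem_image.1 hc
    exact ⟨y, hy, by rw [ha, hb]; abel⟩
  have mN₃ : ∀ y ∈ U₀, a₀ + t - y ∈ N₃ := fun y hy => by
    rw [hN₃]
    exact mem_sumset₃.2 ⟨a₀, by rw [hS₀a]; exact mem_singleton_self _, t, by
      rw [hT₀t]; exact mem_singleton_self _, -y, by rw [eU₁']; exact mem_image_of_mem _ hy, by abel⟩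
  have memN₂ : ∀ p ∈ N₂, ∃ x ∈ T₁, ∃ z ∈ U₁, p = a₀ + x + (-c₀ - z) := by
    intro p hp
    rw [hN₂, mem_sumset₃] at hp
    obtain ⟨a, ha, b, hb, c, hc, rfl⟩ := hp
    rw [hS₀a, mem_singleton] at ha
    rw [eU₀'] at hc
    obtain ⟨z, hz, rfl⟩ := mem_image.1 hc
    exact ⟨b, hb, z, hz, by rw [ha]⟩
  have mN₂ : ∀ x ∈ T₁, ∀ z ∈ U₁, a₀ + x + (-c₀ - z) ∈ N₂ := fun x hx z hz => by
    rw [hN₂]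
    exact mem_sumset₃.2 ⟨a₀, by rw [hS₀a]; exact mem_singleton_self _, x, hx, -c₀ - z, by
      rw [eU₀']; exact mem_image_of_mem _ hz, rfl⟩
  set M := N₃ ∪ N₃.image (· + c₀) with hM
  have hN₃c : Disjoint N₃ (N₃.image (· + c₀)) := by
    rw [disjoint_left]
    intro p hp hp'
    obtain ⟨q, hq, rfl⟩ := mem_image.1 hp'
    obtain ⟨y, hy, ey⟩ := memN₃ _ hp
    obtain ⟨y', hy', ey'⟩ := memN₃ _ hq
    have hyy : y' = y + c₀ := by
      have : a₀ + t - y' + c₀ = a₀ + t - y := by rw [← ey', ← ey]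
      linear_combination (norm := abel1) -this
    rcases memU₀ y hy with ey1 | ey1 <;> rcases memU₀ y' hy' with ey2 | ey2 <;> rw [ey1, ey2] at hyy
    · exact hc₀ (by linear_combination (norm := abel1) -hyy)
    · exact hdU (by rw [hyy]; abel)
    · apply hdU
      linear_combination (norm := abel1) -hyy - h2c
    · exact hc₀ (by linear_combination (norm := abel1) -hyy)
  have cM : M.card = 4 := by
    rw [hM, card_union_of_disjoint hN₃c, card_image_of_injective _ (add_left_injective c₀), cN₃]
  have dN₁M : Disjoint N₁ M := by
    rw [hM, disjoint_union_right]; exact ⟨e₃.symm, f₁⟩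
  have dN₂M : Disjoint N₂ M := by
    rw [hM, disjoint_union_right]; exact ⟨e₂, f₂.symm⟩
  have hT₁d : ∀ x ∈ T₁, x + d ∈ T₁ := by
    intro x hx
    rcases memT₁ x hx with rfl | rfl
    · rw [← ht₂]; exact ht₂m
    · rw [show x + d = t₁ + (d + d) by rw [ht₂]; abel, hdd, add_zero]; exact ht₁m
  have hN₂d : ∀ p ∈ N₂, p + d ∈ N₂ := by
    intro p hp
    obtain ⟨x, hx, z, hz, rfl⟩ := memN₂ p hp
    rw [show a₀ + x + (-c₀ - z) + d = a₀ + (x + d) + (-c₀ - z) by abel]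
    exact mN₂ _ (hT₁d x hx) z hz
  have hMd : ∀ p ∈ M, p + d ∈ M := by
    intro p hp
    rw [hM, mem_union] at hp ⊢
    have negd : -d = d := by linear_combination (norm := abel1) -hdd
    rcases hp with hp | hp
    · obtain ⟨y, hy, rfl⟩ := memN₃ p hp
      rcases memU₀ y hy with ey1 | ey1 <;> rw [ey1]
      · -- `a₀ + t − u₁ + d = (a₀ + t − u₂) + c₀`
        right
        exact mem_image.2 ⟨a₀ + t - u₂, mN₃ u₂ hu₂m, by rw [hu₂]; linear_combination (norm := abel1) -hdd⟩
      · -- `a₀ + t − u₂ + d = (a₀ + t − u₁) + c₀`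
        right
        exact mem_image.2 ⟨a₀ + t - u₁, mN₃ u₁ hu₁m, by rw [hu₂]; linear_combination (norm := abel1) h2c⟩
    · obtain ⟨q, hq, rfl⟩ := mem_image.1 hp
      obtain ⟨y, hy, rfl⟩ := memN₃ q hq
      rcases memU₀ y hy with ey1 | ey1 <;> rw [ey1]
      · left
        rw [show a₀ + t - u₁ + c₀ + d = a₀ + t - u₂ by rw [hu₂]; linear_combination (norm := abel1) h2c + hdd]
        exact mN₃ u₂ hu₂m
      · left
        rw [show a₀ + t - u₂ + c₀ + d = a₀ + t - u₁ by rw [hu₂]; abel]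
        exact mN₃ u₁ hu₁m
  have hN₁d : N₁.image (· + d) = N₁ := by
    refine periodic_of_exact_vertex e₁ dN₁M dN₂M (by rw [cN₁, cN₂, cM, hA]) ?_ ?_
    · rw [disjoint_left]
      intro p hp hp2
      obtain ⟨q, hq, rfl⟩ := mem_image.1 hp
      have : q + d + d ∈ N₂ := hN₂d _ hp2
      rw [add_assoc, hdd, add_zero] at this
      exact disjoint_left.1 e₁ hq this
    · rw [disjoint_left]
      intro p hp hp2
      obtain ⟨q, hq, rfl⟩ := mem_image.1 hp
      have : q + d + d ∈ M := hMd _ hp2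
      rw [add_assoc, hdd, add_zero] at this
      exact disjoint_left.1 dN₁M hq this
  have hU₀'d : U₀'.image (· + d) = U₀' := by
    rw [hN₁, hS₁s, hT₀t] at hN₁d; exact periodic_third_of_box_singletons hN₁d
  obtain ⟨v, hv⟩ := hU₁ne
  have hv' : -c₀ - v ∈ U₀' := by rw [eU₀']; exact mem_image_of_mem _ hv
  have hvd : -c₀ - v + d ∈ U₀' := by rw [← hU₀'d]; exact mem_image_of_mem _ hv'
  rw [eU₀'] at hvd
  obtain ⟨v', hv'U, ev⟩ := mem_image.1 hvd
  have hv'd : v' = v + d := by linear_combination (norm := abel1) -ev - hdd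
  exact ht12 (iTU₁ t₁ ht₁m t₂ ht₂m v' hv'U v hv (by rw [hv'd, ht₂]; abel)).1

end ShapeD

end Summit.MatrixMultiplication.OmegaCensus
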